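import Mathlib
import Summits.ValiantsHypothesis.ValiantsHypothesis.Theorems.BarrierLeverPartitionMinorsHitByVPSimplexJoinBoxGameSquareDrain

/-!
# Route BarrierLever — item `PartitionMinorsHitByVP` (stmt-ValiantsHypothesis-19717), line `hidden_states`:
# THE SQUARE DRAIN FOR THE SHARP (LAYER-CAKE) FLOOR

Helper file (`--supports stmt-ValiantsHypothesis-19717`; cell valiant-natproofs, rung V4, 𝒟-side door (c), line
`Cruxes/PartitionMinorsHitByVP/Lines/hidden_states.lean` v8, registered stub `stub_simplexPairLower`; prover seat val-np-p3 gen 15).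
Definition-free. Closes NO item. Twin of `…BoxGameSquareDrain` (the crude floor) for the layer-cake floor of p656478, the interface of
record: for every SHARP-floor winning predicate `W` and every `k ≥ 1`, a position with `k` column-disjoint 2×2 squares is dead whenever
`r ≤ hd + 2k − 1` and `r + 2k + 4 ≤ 2·hd` (`not_boxWinning_squares_drain_layerCake`). Same adversary induction (demand `3`; squares are
coloured in pairs; at most one square meets the 3-column child; induction on `k` down to the static law `not_boxWinning_cubes_layerCake`,
p665496); the only new ingredient is the legality of the demand under the sharp floor: below the radius-2 ball the layer-cake sum is
`S(hd, r) ≤ (r − 1) + (r − 1 − hd) ≤ 3·hd` (`layerCake_le_two_terms`). Exact census (val-np-p3 g15 lab/probe4.py, sharp floor):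
`v*(n, k squares + units) = n + 2k` — the law is tight.

WHAT THIS IS NOT: a necessary condition on winning predicates; item 19717 OPEN; nothing on crux 14610 or VP ≠ VNP.
-/

set_option linter.dupNamespace false

namespace Summit.ValiantsHypothesis.ValiantsHypothesis.Theorems.BarrierLever.SimplexJoin.Cut

open Finset Matrix
open Summit.ValiantsHypothesis.ValiantsHypothesis.Theorems.BarrierLever.HiddenStates

noncomputable section

/-- Below the radius-2 ball the layer-cake sum has only its first two terms: for `2 ≤ hd` and `r ≤ 1 + hd + C(hd,2)`,
`S(hd, r) = Σ_{d<hd} (r − B_d(hd))⁺ ≤ (r − 1) + (r − 1 − hd)`. -/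
theorem layerCake_le_two_terms (hd r : ℕ) (hhd : 2 ≤ hd) (hr : r ≤ 1 + hd + hd.choose 2) :
    (∑ d ∈ Finset.range hd, (r - ∑ j ∈ Finset.range (d + 1), hd.choose j)) ≤ (r - 1) + (r - 1 - hd) := by
  have hterm : ∀ d ∈ Finset.range hd, (r - ∑ j ∈ Finset.range (d + 1), hd.choose j)
      ≤ if d < 2 then (r - ∑ j ∈ Finset.range (d + 1), hd.choose j) else 0 := by
    intro d _
    by_cases h2 : d < 2
    · rw [if_pos h2]
    · rw [if_neg h2]
      have hge : (∑ j ∈ Finset.range (2 + 1), hd.choose j) ≤ ∑ j ∈ Finset.range (d + 1), hd.choose j :=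
        Finset.sum_le_sum_of_subset (Finset.range_subset_range.mpr (by omega))
      have h3 : (∑ j ∈ Finset.range (2 + 1), hd.choose j) = 1 + hd + hd.choose 2 := by
        simp [Finset.sum_range_succ, Nat.choose_zero_right, Nat.choose_one_right]
      exact le_of_eq (Nat.sub_eq_zero_of_le (by omega))
  refine (Finset.sum_le_sum hterm).trans ?_
  rw [← Finset.sum_filter]
  have hfil : (Finset.range hd).filter (fun d => d < 2) = Finset.range 2 := by
    ext d
    simp only [Finset.mem_filter, Finset.mem_range]
    omega
  rw [hfil]
  simp [Finset.sum_range_succ, Nat.choose_zero_right, Nat.choose_one_right]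
  omega

/-- **THE SQUARE DRAIN (layer-cake floor).** As `not_boxWinning_squares_drain`, for the sharp-floor box game of p656478 (the demand
`3` stays legal: `S(hd,r) ≤ 2r − hd − 2 ≤ 3·hd`); static base `not_boxWinning_cubes_layerCake` (p665496). -/
theorem not_boxWinning_squares_drain_layerCake {m D N : ℕ}
    (W : (hd : ℕ) → (r : ℕ) → (Fin r → Fin m × (Fin D → Option (Fin N))) → Prop)
    (hwin : ∀ (hd r : ℕ) (e : Fin r → Fin m × (Fin D → Option (Fin N))), W hd r e → 2 ≤ r → 1 ≤ hd →
      ∀ r₀ r₁ : ℕ, r₀ + r₁ = r →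
        (∑ d ∈ Finset.range hd, (r - ∑ j ∈ Finset.range (d + 1), hd.choose j) + hd - 1) / hd ≤ r₁ → r₁ ≤ r₀ →
        r₀ ≤ 2 ^ (hd - 1) →
        ∃ (f : Fin m → Fin D) (side : Fin m → Option (Fin N) → Bool) (g₀ : Fin r₀ → Fin r) (g₁ : Fin r₁ → Fin r),
          Function.Injective (Sum.elim g₀ g₁) ∧
          (∀ j, side (e (g₀ j)).1 ((e (g₀ j)).2 (f (e (g₀ j)).1)) = false) ∧
          (∀ j, side (e (g₁ j)).1 ((e (g₁ j)).2 (f (e (g₁ j)).1)) = true) ∧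
          W (hd - 1) r₀ (fun j => e (g₀ j)) ∧ W (hd - 1) r₁ (fun j => e (g₁ j))) :
    ∀ (k : ℕ), 1 ≤ k → ∀ (r hd : ℕ) (e : Fin r → Fin m × (Fin D → Option (Fin N))) (i : Fin k → (Fin (1 + 1) → Fin 2) → Fin r),
      r ≤ hd + 2 * k - 1 → r + 2 * k + 4 ≤ 2 * hd →
      (Function.Injective fun lz : Fin k × (Fin (1 + 1) → Fin 2) => i lz.1 lz.2) →
      (∀ l z, (e (i l z)).1 = (e (i l fun _ => 0)).1) →
      (∀ l (φ : Fin D), ∃ c : Fin (1 + 1), ∀ z z', z c = z' c → (e (i l z)).2 φ = (e (i l z')).2 φ) →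
      ¬ W hd r e := by
  intro k
  induction k with
  | zero => intro hk; omega
  | succ k IHk =>
  intro _ r hd e i hr hbud hinj hpiece hsq hW
  classical
  -- the static zone `r ≤ hd + k + 1` is the multi-cube law at `t = 1`
  have hB1 : (∑ j ∈ Finset.range (1 + 1), hd.choose j) = 1 + hd := by
    simp [Finset.sum_range_succ]
  have hB2 : (∑ j ∈ Finset.range (1 + 2), hd.choose j) = 1 + hd + hd.choose 2 := by
    rw [show (1 + 2 : ℕ) = 3 from rfl]
    simp [Finset.sum_range_succ, Nat.choose_zero_right, Nat.choose_one_right]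
  by_cases hstatic : r < 1 + hd + (k + 1)
  · have hk3 : k + 3 ≤ hd := by omega
    have hc : 2 * k ≤ hd.choose 2 := by
      rw [Nat.choose_two_right, Nat.le_div_iff_mul_le (by norm_num)]
      have h1 : (k + 3) * (k + 2) ≤ hd * (hd - 1) := Nat.mul_le_mul hk3 (by omega)
      nlinarith
    have hr1 : r < (∑ j ∈ Finset.range (1 + 1), hd.choose j) + (k + 1) := by rw [hB1]; exact hstatic
    have hr2 : r ≤ ∑ j ∈ Finset.range (1 + 2), hd.choose j := by rw [hB2]; omega
    exact not_boxWinning_cubes_layerCake W hwin 1 (k + 1) (by omega) r hd e i hr1 hr2 hinj hpiece hsq hW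
  -- the dynamic zone: `hd + k + 2 ≤ r ≤ hd + 2k + 1`, so `k ≥ 1`, `hd ≥ 3k + 8`, `r ≥ 10`
  push Not at hstatic
  have hk1 : 1 ≤ k := by omega
  have hhd : 3 * k + 8 ≤ hd := by omega
  -- the demand (r − 3, 3) is legal
  have hfloor : (∑ d ∈ Finset.range hd, (r - ∑ j ∈ Finset.range (d + 1), hd.choose j) + hd - 1) / hd ≤ 3 := by
    have hc : 2 * k ≤ hd.choose 2 := by
      rw [Nat.choose_two_right, Nat.le_div_iff_mul_le (by norm_num)]
      have h1 : (k + 3) * (k + 2) ≤ hd * (hd - 1) := Nat.mul_le_mul (by omega) (by omega)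
      nlinarith
    have hS := layerCake_le_two_terms hd r (by omega) (by omega)
    rw [Nat.div_le_iff_le_mul_add_pred (by omega)]
    omega
  have hpow : r - 3 ≤ 2 ^ (hd - 1) := by
    have := two_mul_le_two_pow_pred hd (by omega)
    omega
  obtain ⟨f, side, g₀, g₁, hg, hfalse, htrue, hW0, -⟩ :=
    hwin hd r e hW (by omega) (by omega) (r - 3) 3 (by omega) hfloor (by omega) hpow
  set col : Fin r → Bool := fun x => side (e x).1 ((e x).2 (f (e x).1)) with hcol
  -- `Sum.elim g₀ g₁` is a bijection; `true` columns are exactly the range of `g₁`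
  have hsurj : Function.Surjective (Sum.elim g₀ g₁) := by
    have hbij := (Fintype.bijective_iff_injective_and_card _).mpr
      ⟨hg, by simp [Fintype.card_sum, Fintype.card_fin]; omega⟩
    exact hbij.2
  have hg₁inj : Function.Injective g₁ := fun a b h => Sum.inr_injective (hg (by simpa using h))
  have htrue_range : ∀ x, col x = true → x ∈ Set.range g₁ := by
    intro x hx
    obtain ⟨s, hs⟩ := hsurj x
    rcases s with j | j
    · have : col x = false := by rw [← hs]; exact hfalse j
      rw [hx] at this; exact absurd this (by decide)
    · exact ⟨j, hs⟩
  have hfalse_pre : ∀ x, col x = false → ∃ j, g₀ j = x := by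
    intro x hx
    obtain ⟨s, hs⟩ := hsurj x
    rcases s with j | j
    · exact ⟨j, hs⟩
    · have : col x = true := by rw [← hs]; exact htrue j
      rw [hx] at this; exact absurd this (by decide)
  -- partners: in square `l`, flipping the coordinate the chosen slot does not read keeps the colour
  choose c hc using hsq
  have hpartner : ∀ l (z : Fin (1 + 1) → Fin 2), ∃ z', z' ≠ z ∧ col (i l z') = col (i l z) := by
    intro l z
    set p : Fin m := (e (i l fun _ => 0)).1 with hp
    set c₀ : Fin (1 + 1) := c l (f p) with hc₀
    let z' : Fin (1 + 1) → Fin 2 := Function.update z (c₀ + 1) (z (c₀ + 1) + 1)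
    have hne : c₀ + 1 ≠ c₀ := by
      intro h
      have := congrArg (fun x : Fin (1 + 1) => (x : ℕ)) h
      simp [Fin.val_add] at this
      omega
    have hz'c : z' c₀ = z c₀ := by
      simp only [z', Function.update_of_ne hne.symm]
    have hz'ne : z' ≠ z := by
      intro h
      have := congrFun h (c₀ + 1)
      simp only [z', Function.update_self] at this
      have := congrArg (fun x : Fin 2 => (x : ℕ)) this
      simp [Fin.val_add] at this
      omega
    refine ⟨z', hz'ne, ?_⟩
    have hslot : (e (i l z')).2 (f p) = (e (i l z)).2 (f p) := hc l (f p) z' z hz'c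
    simp only [hcol, hpiece l z', hpiece l z, ← hp, hslot]
  -- a square with a `true` column has two distinct `true` columns
  have htwo : ∀ l z, col (i l z) = true → ∃ z', z' ≠ z ∧ col (i l z') = true := by
    intro l z hz
    obtain ⟨z', hne, hcz⟩ := hpartner l z
    exact ⟨z', hne, by rw [hcz, hz]⟩
  -- at most one square has a `true` column
  have hatmost : ∀ l₁ l₂ z₁ z₂, col (i l₁ z₁) = true → col (i l₂ z₂) = true → l₁ = l₂ := by
    intro l₁ l₂ z₁ z₂ h1 h2
    by_contra hne
    obtain ⟨z₁', hz₁', h1'⟩ := htwo l₁ z₁ h1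
    obtain ⟨z₂', hz₂', h2'⟩ := htwo l₂ z₂ h2
    have hd : ∀ (a b : Fin (k + 1) × (Fin (1 + 1) → Fin 2)), a ≠ b → i a.1 a.2 ≠ i b.1 b.2 :=
      fun a b hab h => hab (hinj h)
    exact not_four_mem_range_fin_three g₁ (i l₁ z₁) (i l₁ z₁') (i l₂ z₂) (i l₂ z₂')
      (hd (l₁, z₁) (l₁, z₁') (by simp [Ne.symm hz₁']))
      (hd (l₁, z₁) (l₂, z₂) (by simp [hne]))
      (hd (l₁, z₁) (l₂, z₂') (by simp [hne]))
      (hd (l₁, z₁') (l₂, z₂) (by simp [hne]))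
      (hd (l₁, z₁') (l₂, z₂') (by simp [hne]))
      (hd (l₂, z₂) (l₂, z₂') (by simp [Ne.symm hz₂']))
      (htrue_range _ h1) (htrue_range _ h1') (htrue_range _ h2) (htrue_range _ h2')
  -- choose the square to drop: the one meeting the `true` child if any, else square `0`
  have hex : ∃ l₀ : Fin (k + 1), ∀ l, l ≠ l₀ → ∀ z, col (i l z) = false := by
    by_cases hbad : ∃ l z, col (i l z) = true
    · obtain ⟨l₀, z₀, h0⟩ := hbad
      refine ⟨l₀, fun l hl z => ?_⟩
      by_contra hz
      have hz' : col (i l z) = true := by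
        cases hcz : col (i l z) with
        | true => rfl
        | false => exact absurd hcz hz
      exact hl (hatmost l l₀ z z₀ hz' h0)
    · push Not at hbad
      refine ⟨0, fun l _ z => ?_⟩
      cases hcz : col (i l z) with
      | false => rfl
      | true => exact absurd hcz (hbad l z)
  obtain ⟨l₀, hl₀⟩ := hex
  -- pull the other `k` squares back along `g₀`
  have hpre : ∀ (l : Fin k) (z : Fin (1 + 1) → Fin 2), ∃ j, g₀ j = i (Fin.succAbove l₀ l) z :=
    fun l z => hfalse_pre _ (hl₀ _ (Fin.succAbove_ne l₀ l) z)
  choose j hj using hpre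
  refine IHk hk1 (r - 3) (hd - 1) (fun x => e (g₀ x)) j (by omega) (by omega) ?_ ?_ ?_ hW0
  · rintro ⟨l, z⟩ ⟨l', z'⟩ h
    have h' : i (Fin.succAbove l₀ l) z = i (Fin.succAbove l₀ l') z' := by
      have := congrArg g₀ h
      simpa only [hj] using this
    have := hinj (a₁ := (Fin.succAbove l₀ l, z)) (a₂ := (Fin.succAbove l₀ l', z')) h'
    simp only [Prod.mk.injEq] at this
    exact Prod.ext (Fin.succAbove_right_injective this.1) this.2
  · intro l z
    simp only [hj]
    exact hpiece _ z
  · intro l φ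
    obtain ⟨c', hc'⟩ : ∃ c' : Fin (1 + 1), ∀ z z', z c' = z' c' →
        (e (i (Fin.succAbove l₀ l) z)).2 φ = (e (i (Fin.succAbove l₀ l) z')).2 φ := ⟨c _ φ, hc _ φ⟩
    refine ⟨c', fun z z' hzz => ?_⟩
    simp only [hj]
    exact hc' z z' hzz


end

end Summit.ValiantsHypothesis.ValiantsHypothesis.Theorems.BarrierLever.SimplexJoin.Cut
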